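import Mathlib.MeasureTheory.Measure.Portmanteau
import Mathlib.MeasureTheory.Function.ConvergenceInDistribution
import HarnessLib

/-!
# Weak limits and uniformly likely closed sets: support transfer and an almost-continuous mapping theorem

Topic `Literature/Probability/Process` (generic weak-convergence tools; theorems only, no
definition, no named fact). Companion of `PathSpaceCoupling.lean`.

The probabilistic half of Kemppainen–Smirnov's proof of their main theorem (A. Kemppainen,
S. Smirnov, *Random curves, scaling limits and Loewner evolutions*, Ann. Probab. 45 (2017),
Thm. 1.5; arXiv:1212.6215, Thm. 1.3, proof in §3.5, p. 18 of the arXiv text) ends as follows: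
"Fix `ε > 0`. We will first choose four events `E_k`, `k = 1, 2, 3, 4`, that have large
probability, namely, `P(E_k) ≥ 1 - ε/4` for all `P ∈ Σ_𝔻`. … Once we have defined `E_k`, denote
`E = ⋂ E_k`. … Now the rest of the claims follow from Lemma A.5 [the deterministic 'main lemma
with convergence'] of the appendix." The measure theory left implicit in that last sentence —
how a property and a functional that are controlled only on sets `E = E(ε)` of probability
`≥ 1 - ε` UNIFORMLY over the approximating laws pass to every weak (subsequential) limit — is
what this file proves, in Mathlib's vocabulary (`ProbabilityMeasure`, weak convergence as
`Tendsto` in `ProbabilityMeasure E`, `TendstoInDistribution`), by the closed-set form of the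
portmanteau theorem (no Skorokhod representation is used or available):

* `le_measure_of_isClosed_of_frequently_le`, `measure_le_of_isOpen_of_frequently_le` —
  portmanteau for uniformly likely closed sets / uniformly unlikely open sets: if `μs i → μ`
  weakly and `p ≤ μs i F` frequently for a closed `F`, then `p ≤ μ F` (dually for open sets);
* `measure_compl_eq_zero_of_forall_exists_isClosed_subset`, `ae_mem_of_forall_exists_isClosed_subset`
  — **support transfer**: if for every `ε > 0` there is a closed `F ⊆ G` with `μs i Fᶜ ≤ ε`
  frequently, then the weak limit `μ` is carried by `G` (`μ Gᶜ = 0`), however irregular `G` is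
  (KS: `G` = "the curve is described by a Loewner evolution with continuous driving term", `F` =
  the closure of `E(ε)`);
* `tendsto_map_of_forall_exists_isClosed_continuousOn` — **the almost-continuous mapping
  theorem**: if `ψ : E → F'` is (a.e.-)measurable and for every `ε > 0` there is a closed set
  `K` on which `ψ` is continuous (`ContinuousOn ψ K`) with `μs i Kᶜ ≤ ε` eventually, then
  `μs i ∘ ψ⁻¹ → μ ∘ ψ⁻¹` weakly (proof: for `C` closed, `K ∩ ψ⁻¹ C` is closed, so
  `limsup μs i (ψ⁻¹ C) ≤ limsup μs i (K ∩ ψ⁻¹ C) + ε ≤ μ (K ∩ ψ⁻¹ C) + ε ≤ μ (ψ⁻¹ C) + ε`);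
  this is the variant of the mapping theorem (Billingsley, *Convergence of Probability
  Measures*, §2, "the mapping theorem": `P(D_ψ) = 0` suffices) adapted to functionals such as
  the Loewner driving term of a curve, which are continuous on each `E(ε)` but nowhere
  continuous on the whole curve space;
* `tendstoInDistribution_comp_of_forall_exists_isClosed_continuousOn`,
  `tendstoInDistribution_prodMk_comp_of_forall_exists_isClosed_continuousOn`,
  `ae_mem_of_tendstoInDistribution_of_forall_exists_isClosed_subset` — the same three facts for
  random variables `X i → Z` in distribution (`MeasureTheory.TendstoInDistribution`), including
  the JOINT convergence `(X i, ψ (X i)) → (Z, ψ Z)` (KS Thm. 1.5 (iii) / Cor. 1.7: the curves and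
  their driving processes converge jointly).

## Mathlib

USED: `ProbabilityMeasure.limsup_measure_closed_le_of_tendsto`,
`ProbabilityMeasure.le_liminf_measure_open_of_tendsto` (portmanteau, (T) ⇒ (C)/(O)),
`tendsto_of_forall_isClosed_limsup_le'` ((C) ⇒ (T)), `ContinuousOn.preimage_isClosed_of_isClosed`,
`limsup_add_const`, `TendstoInDistribution`. MISSING: any mapping theorem beyond
`TendstoInDistribution.continuous_comp` (everywhere-continuous `ψ`); Skorokhod's representation
theorem.

## References

* A. Kemppainen, S. Smirnov, Ann. Probab. 45 (2017) 698–779, proof of Thm. 1.5 (§3.5 of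
  arXiv:1212.6215: proof of Thm. 1.3, p. 18). [KemppainenSmirnov2017]
* P. Billingsley, *Convergence of Probability Measures*, 2nd ed., Wiley (1999), §2 (portmanteau
  and mapping theorems). [Billingsley1999]
-/

noncomputable section

open Set Filter Topology MeasureTheory
open scoped NNReal ENNReal

namespace Literature.Probability.Process

/-- Splitting a set along a "good" set `K`: `ν s ≤ ν (K ∩ s) + ν Kᶜ`. [folklore] -/
theorem measure_le_measure_inter_add_measure_compl {α : Type*} {_ : MeasurableSpace α}
    (ν : Measure α) (K s : Set α) : ν s ≤ ν (K ∩ s) + ν Kᶜ := by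
  refine (measure_mono fun x hx ↦ ?_).trans (measure_union_le (K ∩ s) Kᶜ)
  by_cases hxK : x ∈ K
  · exact Or.inl ⟨hxK, hx⟩
  · exact Or.inr hxK

variable {E : Type*} [MeasurableSpace E] [TopologicalSpace E]

section ClosedSets

variable [HasOuterApproxClosed E] [OpensMeasurableSpace E] {ι : Type*} {L : Filter ι}
  {μs : ι → ProbabilityMeasure E} {μ : ProbabilityMeasure E}

/-- **Portmanteau for uniformly likely closed sets.** If `μs i → μ` weakly, `F` is closed and
`p ≤ μs i F` frequently along the filter, then `p ≤ μ F`
(`p ≤ limsup μs i F ≤ μ F`). [folklore] -/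
theorem le_measure_of_isClosed_of_frequently_le (hlim : Tendsto μs L (𝓝 μ)) {F : Set E}
    (hF : IsClosed F) {p : ℝ≥0∞} (h : ∃ᶠ i in L, p ≤ (μs i : Measure E) F) :
    p ≤ (μ : Measure E) F :=
  (le_limsup_of_frequently_le' h).trans
    (ProbabilityMeasure.limsup_measure_closed_le_of_tendsto hlim hF)

/-- **Portmanteau for uniformly unlikely open sets.** If `μs i → μ` weakly, `U` is open and
`μs i U ≤ p` frequently along the filter, then `μ U ≤ p` (`μ U ≤ liminf μs i U ≤ p`).
[folklore] -/
theorem measure_le_of_isOpen_of_frequently_le (hlim : Tendsto μs L (𝓝 μ)) {U : Set E}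
    (hU : IsOpen U) {p : ℝ≥0∞} (h : ∃ᶠ i in L, (μs i : Measure E) U ≤ p) :
    (μ : Measure E) U ≤ p :=
  (ProbabilityMeasure.le_liminf_measure_open_of_tendsto hlim hU).trans
    (liminf_le_of_frequently_le' h)

/-- **Support transfer to weak limits.** Let `μs i → μ` weakly. If for every `ε > 0` there is
a closed set `F ⊆ G` with `μs i Fᶜ ≤ ε` frequently along the filter, then `μ Gᶜ = 0`: the weak
limit is carried by `G` (no regularity of `G` is needed). This is the step "`P(E) ≥ 1 - ε` for
all `P ∈ Σ` … the rest follows from [the deterministic main lemma]" of Kemppainen–Smirnov's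
proof of their Thm. 1.5 (arXiv:1212.6215, §3.5), isolated. [folklore] -/
theorem measure_compl_eq_zero_of_forall_exists_isClosed_subset (hlim : Tendsto μs L (𝓝 μ))
    {G : Set E}
    (h : ∀ ε : ℝ≥0∞, 0 < ε → ∃ F : Set E, IsClosed F ∧ F ⊆ G ∧
      ∃ᶠ i in L, (μs i : Measure E) Fᶜ ≤ ε) :
    (μ : Measure E) Gᶜ = 0 := by
  refine nonpos_iff_eq_zero.1 (ENNReal.le_of_forall_pos_le_add fun ε hε _ ↦ ?_)
  obtain ⟨F, hF, hFG, hfr⟩ := h ε (by exact_mod_cast hε)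
  rw [zero_add]
  exact (measure_mono (compl_subset_compl.2 hFG)).trans
    (measure_le_of_isOpen_of_frequently_le hlim hF.isOpen_compl hfr)

/-- **Support transfer to weak limits, a.e. form.** Under the hypotheses of
`measure_compl_eq_zero_of_forall_exists_isClosed_subset`, `μ`-a.e. point lies in `G`. [folklore] -/
theorem ae_mem_of_forall_exists_isClosed_subset (hlim : Tendsto μs L (𝓝 μ)) {G : Set E}
    (h : ∀ ε : ℝ≥0∞, 0 < ε → ∃ F : Set E, IsClosed F ∧ F ⊆ G ∧
      ∃ᶠ i in L, (μs i : Measure E) Fᶜ ≤ ε) :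
    ∀ᵐ x ∂(μ : Measure E), x ∈ G :=
  measure_compl_eq_zero_of_forall_exists_isClosed_subset hlim h

/-- **The almost-continuous mapping theorem.** Let `μs i → μ` weakly (along a countably
generated filter) and let `ψ : E → F'` be a.e.-measurable for all these measures. Suppose that
for every `ε > 0` there is a closed set `K ⊆ E` on which `ψ` is continuous (`ContinuousOn ψ K`)
and which is eventually `ε`-likely: `μs i Kᶜ ≤ ε` eventually along the filter. Then the image
laws converge weakly: `μs i ∘ ψ⁻¹ → μ ∘ ψ⁻¹`. Proof by the closed-set portmanteau criterion:
for `C ⊆ F'` closed, `K ∩ ψ⁻¹ C` is closed, whence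
`limsup μs i (ψ⁻¹ C) ≤ limsup μs i (K ∩ ψ⁻¹ C) + ε ≤ μ (K ∩ ψ⁻¹ C) + ε ≤ μ (ψ⁻¹ C) + ε`.
(Billingsley's mapping theorem asks instead `μ (D_ψ) = 0`; the present variant is the one the
Loewner driving term of a random curve satisfies, Kemppainen–Smirnov 2017, proof of Thm. 1.5.)
[folklore] -/
theorem tendsto_map_of_forall_exists_isClosed_continuousOn {F' : Type*} [MeasurableSpace F']
    [TopologicalSpace F'] [OpensMeasurableSpace F'] [L.IsCountablyGenerated]
    (hlim : Tendsto μs L (𝓝 μ)) {ψ : E → F'} (hψs : ∀ i, AEMeasurable ψ (μs i : Measure E))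
    (hψ : AEMeasurable ψ (μ : Measure E))
    (h : ∀ ε : ℝ≥0∞, 0 < ε → ∃ K : Set E, IsClosed K ∧ ContinuousOn ψ K ∧
      ∀ᶠ i in L, (μs i : Measure E) Kᶜ ≤ ε) :
    Tendsto (fun i ↦ (μs i).map (hψs i)) L (𝓝 (μ.map hψ)) := by
  rcases L.eq_or_neBot with rfl | hL
  · exact tendsto_bot
  refine tendsto_of_forall_isClosed_limsup_le' fun C hC ↦ ?_
  have hrw : ∀ i, (((μs i).map (hψs i) : ProbabilityMeasure F') : Measure F') C =
      (μs i : Measure E) (ψ ⁻¹' C) := fun i ↦ by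
    rw [ProbabilityMeasure.toMeasure_map, Measure.map_apply_of_aemeasurable (hψs i) hC.measurableSet]
  have hrw' : ((μ.map hψ : ProbabilityMeasure F') : Measure F') C = (μ : Measure E) (ψ ⁻¹' C) := by
    rw [ProbabilityMeasure.toMeasure_map, Measure.map_apply_of_aemeasurable hψ hC.measurableSet]
  simp_rw [hrw, hrw']
  refine ENNReal.le_of_forall_pos_le_add fun ε hε _ ↦ ?_
  obtain ⟨K, hK, hψK, hev⟩ := h ε (by exact_mod_cast hε)
  have hKC : IsClosed (K ∩ ψ ⁻¹' C) := hψK.preimage_isClosed_of_isClosed hK hC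
  calc limsup (fun i ↦ (μs i : Measure E) (ψ ⁻¹' C)) L
      ≤ limsup (fun i ↦ (μs i : Measure E) (K ∩ ψ ⁻¹' C) + (ε : ℝ≥0∞)) L := by
        refine limsup_le_limsup ?_ (by isBoundedDefault) (by isBoundedDefault)
        filter_upwards [hev] with i hi
        exact (measure_le_measure_inter_add_measure_compl _ K _).trans (add_le_add le_rfl hi)
    _ = limsup (fun i ↦ (μs i : Measure E) (K ∩ ψ ⁻¹' C)) L + (ε : ℝ≥0∞) :=
        limsup_add_const L _ _ (by isBoundedDefault) (by isBoundedDefault)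
    _ ≤ (μ : Measure E) (K ∩ ψ ⁻¹' C) + ε :=
        add_le_add (ProbabilityMeasure.limsup_measure_closed_le_of_tendsto hlim hKC) le_rfl
    _ ≤ (μ : Measure E) (ψ ⁻¹' C) + ε := add_le_add (measure_mono inter_subset_right) le_rfl

end ClosedSets

/-! ### Random variables converging in distribution -/

section InDistribution

variable [HasOuterApproxClosed E] [OpensMeasurableSpace E] {ι : Type*} {L : Filter ι}
  {Ω : ι → Type*} {mΩ : ∀ i, MeasurableSpace (Ω i)} {P : ∀ i, Measure (Ω i)}
  [∀ i, IsProbabilityMeasure (P i)] {Ω' : Type*} {mΩ' : MeasurableSpace Ω'} {P' : Measure Ω'}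
  [IsProbabilityMeasure P'] {X : ∀ i, Ω i → E} {Z : Ω' → E}

/-- **Support transfer for limits in distribution.** If `X i → Z` in distribution and for every
`ε > 0` there is a closed set `F ⊆ G` with `P i (X i ∉ F) ≤ ε` frequently, then `Z ∈ G` almost
surely. [folklore] -/
theorem ae_mem_of_tendstoInDistribution_of_forall_exists_isClosed_subset
    (hX : TendstoInDistribution X L Z P P') {G : Set E}
    (h : ∀ ε : ℝ≥0∞, 0 < ε → ∃ F : Set E, IsClosed F ∧ F ⊆ G ∧
      ∃ᶠ i in L, P i (X i ⁻¹' Fᶜ) ≤ ε) :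
    ∀ᵐ ω ∂P', Z ω ∈ G := by
  have hmain := measure_compl_eq_zero_of_forall_exists_isClosed_subset hX.tendsto (G := G)
    fun ε hε ↦ by
      obtain ⟨F, hF, hFG, hfr⟩ := h ε hε
      refine ⟨F, hF, hFG, hfr.mono fun i hi ↦ ?_⟩
      rw [ProbabilityMeasure.coe_mk,
        Measure.map_apply_of_aemeasurable (hX.forall_aemeasurable i) hF.isOpen_compl.measurableSet]
      exact hi
  -- `G` need not be measurable: compare with the outer measure of the image law
  have hle : P' (Z ⁻¹' Gᶜ) ≤ (P'.map Z) Gᶜ := Measure.le_map_apply hX.aemeasurable_limit _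
  have h0 : P' (Z ⁻¹' Gᶜ) = 0 := nonpos_iff_eq_zero.1 (hle.trans (le_of_eq hmain))
  exact h0

/-- **The almost-continuous mapping theorem for convergence in distribution.** If `X i → Z` in
distribution, `ψ` is measurable, and for every `ε > 0` there is a closed set `K` with
`ContinuousOn ψ K` and `P i (X i ∉ K) ≤ ε` eventually, then `ψ (X i) → ψ Z` in distribution.
(Generalises Mathlib's `TendstoInDistribution.continuous_comp`.) [folklore] -/
theorem tendstoInDistribution_comp_of_forall_exists_isClosed_continuousOn {F' : Type*}
    [MeasurableSpace F'] [TopologicalSpace F'] [OpensMeasurableSpace F'] [L.IsCountablyGenerated]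
    (hX : TendstoInDistribution X L Z P P') {ψ : E → F'} (hψ : Measurable ψ)
    (h : ∀ ε : ℝ≥0∞, 0 < ε → ∃ K : Set E, IsClosed K ∧ ContinuousOn ψ K ∧
      ∀ᶠ i in L, P i (X i ⁻¹' Kᶜ) ≤ ε) :
    TendstoInDistribution (fun i ↦ ψ ∘ X i) L (ψ ∘ Z) P P' where
  forall_aemeasurable i := hψ.comp_aemeasurable (hX.forall_aemeasurable i)
  aemeasurable_limit := hψ.comp_aemeasurable hX.aemeasurable_limit
  tendsto := by
    have key := tendsto_map_of_forall_exists_isClosed_continuousOn (F' := F') hX.tendsto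
      (fun _ ↦ hψ.aemeasurable) hψ.aemeasurable fun ε hε ↦ by
        obtain ⟨K, hK, hψK, hev⟩ := h ε hε
        refine ⟨K, hK, hψK, hev.mono fun i hi ↦ ?_⟩
        rw [ProbabilityMeasure.coe_mk,
          Measure.map_apply_of_aemeasurable (hX.forall_aemeasurable i)
            hK.isOpen_compl.measurableSet]
        exact hi
    have h1 : ∀ i, (⟨(P i).map (ψ ∘ X i), Measure.isProbabilityMeasure_map
          (hψ.comp_aemeasurable (hX.forall_aemeasurable i))⟩ : ProbabilityMeasure F') =
        ProbabilityMeasure.map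
          (⟨(P i).map (X i), Measure.isProbabilityMeasure_map (hX.forall_aemeasurable i)⟩ :
            ProbabilityMeasure E) hψ.aemeasurable := fun i ↦ by
      apply ProbabilityMeasure.toMeasure_injective
      rw [ProbabilityMeasure.toMeasure_map, ProbabilityMeasure.coe_mk, ProbabilityMeasure.coe_mk,
        AEMeasurable.map_map_of_aemeasurable hψ.aemeasurable (hX.forall_aemeasurable i)]
    have h2 : (⟨P'.map (ψ ∘ Z), Measure.isProbabilityMeasure_map
          (hψ.comp_aemeasurable hX.aemeasurable_limit)⟩ : ProbabilityMeasure F') =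
        ProbabilityMeasure.map
          (⟨P'.map Z, Measure.isProbabilityMeasure_map hX.aemeasurable_limit⟩ :
            ProbabilityMeasure E) hψ.aemeasurable := by
      apply ProbabilityMeasure.toMeasure_injective
      rw [ProbabilityMeasure.toMeasure_map, ProbabilityMeasure.coe_mk, ProbabilityMeasure.coe_mk,
        AEMeasurable.map_map_of_aemeasurable hψ.aemeasurable hX.aemeasurable_limit]
    convert key using 1
    · funext i
      exact h1 i
    · rw [h2]

/-- **Joint convergence in distribution of `(X i, ψ (X i))`.** Under the hypotheses of
`tendstoInDistribution_comp_of_forall_exists_isClosed_continuousOn`, the pairs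
`(X i, ψ (X i))` converge in distribution to `(Z, ψ Z)` (Kemppainen–Smirnov 2017, Thm. 1.5 (iii)
with Cor. 1.7: a random curve and its driving process converge jointly). [folklore] -/
theorem tendstoInDistribution_prodMk_comp_of_forall_exists_isClosed_continuousOn {F' : Type*}
    [MeasurableSpace F'] [TopologicalSpace F'] [OpensMeasurableSpace (E × F')]
    [L.IsCountablyGenerated]
    (hX : TendstoInDistribution X L Z P P') {ψ : E → F'} (hψ : Measurable ψ)
    (h : ∀ ε : ℝ≥0∞, 0 < ε → ∃ K : Set E, IsClosed K ∧ ContinuousOn ψ K ∧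
      ∀ᶠ i in L, P i (X i ⁻¹' Kᶜ) ≤ ε) :
    TendstoInDistribution (fun i ω ↦ (X i ω, ψ (X i ω))) L (fun ω ↦ (Z ω, ψ (Z ω))) P P' :=
  tendstoInDistribution_comp_of_forall_exists_isClosed_continuousOn (F' := E × F') hX
    (measurable_id.prodMk hψ) fun ε hε ↦ by
      obtain ⟨K, hK, hψK, hev⟩ := h ε hε
      exact ⟨K, hK, continuousOn_id.prodMk hψK, hev⟩

end InDistribution

end Literature.Probability.Process
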